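import Mathlib.Analysis.MellinInversion
import Mathlib.NumberTheory.LSeries.Dirichlet
import Mathlib.NumberTheory.Chebyshev
import Mathlib.Analysis.SpecialFunctions.ImproperIntegrals
import HarnessLib

/-!
# The Riesz mean of `Λ` as a Mellin integral (Perron's formula of order one)

Trunk T-ANT support for the von Koch theorem (Montgomery–Vaughan Thm. 13.1; fact
`Literature.NumberTheory.LFunctions.vonKoch_chebyshevPsi_of_riemannHypothesis`). Everything in this file is PROVED.

For `x > 0` let `ψ₁(x) = ∑_{n ≤ x} Λ(n)(x − n) = ∫₀ˣ ψ(u) du` (the Riesz mean of order one of the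
von Mangoldt function; Ingham Ch. II §5, Ch. IV §4). For `σ > 1`,

  `ψ₁(x) = (1/2πi) ∫_{σ−i∞}^{σ+i∞} x^{s+1}/(s(s+1)) · (−ζ'/ζ(s)) ds`
  `      = (1/2π) ∫_{−∞}^{∞} x^{1+σ+it} (−ζ'/ζ(σ+it)) /((σ+it)(σ+1+it)) dt`

(`rieszMean_vonMangoldt_eq_integral`), the integral converging absolutely. This is Ingham's
Theorem B of Ch. II §5 / (17) of Ch. IV §4 with `k = 1` ("`(1/2πi)∫ y^s ds/(s(s+1)) = 1 − 1/y`
for `y ≥ 1`, `= 0` for `0 < y ≤ 1`"), obtained here from Mathlib's Mellin inversion theorem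
(`mellinInv_mellin_eq`) applied to `f(y) = (1 − y)⁺` on `(0, ∞)`, whose Mellin transform is
`1/(s(s+1))` (`hasMellin_one_Ioc`, `hasMellin_cpow_Ioc`), followed by the absolutely convergent
interchange of `∑_n Λ(n)` and `∫ dt` and `∑ Λ(n) n^{-s} = −ζ'/ζ(s)`
(`ArithmeticFunction.LSeries_vonMangoldt_eq_deriv_riemannZeta_div`).

## References

* A. E. Ingham, *The Distribution of Prime Numbers*, Cambridge Tract 30, CUP 1932, Ch. II §5
  Theorem B; Ch. IV §4 (17)–(18).
* H. L. Montgomery, R. C. Vaughan, *Multiplicative Number Theory I*, CUP 2007, §5.1 (Riesz means,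
  (5.19)–(5.20)), Thm. 13.1.
-/

noncomputable section

open Complex Filter Set MeasureTheory Real ArithmeticFunction
open scoped Topology LSeries.notation

namespace Literature.NumberTheory.LFunctions

/-! ## The kernel `1/(s(s+1))` on vertical lines -/

/-- `‖(σ + it)(σ + 1 + it)‖ ≥ σ² + t²` for `σ ≥ 0`. [folklore] -/
theorem sq_add_sq_le_norm_kernelDen {σ : ℝ} (hσ : 0 ≤ σ) (t : ℝ) :
    σ ^ 2 + t ^ 2 ≤ ‖((σ : ℂ) + t * I) * ((σ : ℂ) + t * I + 1)‖ := by
  rw [norm_mul]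
  have h1 : ‖(σ : ℂ) + t * I‖ = Real.sqrt (σ ^ 2 + t ^ 2) := by
    rw [Complex.norm_def, Complex.normSq_apply]
    congr 1; simp; ring
  have h2 : ‖(σ : ℂ) + t * I + 1‖ = Real.sqrt ((σ + 1) ^ 2 + t ^ 2) := by
    rw [Complex.norm_def, Complex.normSq_apply]
    congr 1; simp; ring
  rw [h1, h2]
  have h3 : Real.sqrt (σ ^ 2 + t ^ 2) ≤ Real.sqrt ((σ + 1) ^ 2 + t ^ 2) :=
    Real.sqrt_le_sqrt (by nlinarith)
  calc σ ^ 2 + t ^ 2 = Real.sqrt (σ ^ 2 + t ^ 2) * Real.sqrt (σ ^ 2 + t ^ 2) :=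
        (Real.mul_self_sqrt (by positivity)).symm
    _ ≤ Real.sqrt (σ ^ 2 + t ^ 2) * Real.sqrt ((σ + 1) ^ 2 + t ^ 2) := by gcongr

/-- The kernel is bounded by `1/(σ² + t²)` on `Re s = σ > 0`. [folklore] -/
theorem norm_kernel_le {σ : ℝ} (hσ : 0 < σ) (t : ℝ) :
    ‖1 / (((σ : ℂ) + t * I) * ((σ : ℂ) + t * I + 1))‖ ≤ 1 / (σ ^ 2 + t ^ 2) := by
  rw [norm_div, norm_one]
  exact one_div_le_one_div_of_le (by positivity) (sq_add_sq_le_norm_kernelDen hσ.le t)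

/-- The kernel does not vanish on `Re s = σ > 0`. [folklore] -/
theorem kernelDen_ne_zero {σ : ℝ} (hσ : 0 < σ) (t : ℝ) :
    ((σ : ℂ) + t * I) * ((σ : ℂ) + t * I + 1) ≠ 0 := by
  intro h
  have := sq_add_sq_le_norm_kernelDen hσ.le t
  rw [h, norm_zero] at this
  nlinarith

/-- `t ↦ 1/(σ² + t²)` is integrable on `ℝ` for `σ > 0`. [folklore] -/
theorem integrable_inv_sq_add_sq {σ : ℝ} (hσ : 0 < σ) :
    Integrable fun t : ℝ ↦ 1 / (σ ^ 2 + t ^ 2) := by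
  have hm : 0 < min (σ ^ 2) 1 := lt_min (by positivity) one_pos
  have h := (integrable_inv_one_add_sq.const_mul (min (σ ^ 2) 1)⁻¹)
  have hc : Continuous fun t : ℝ ↦ 1 / (σ ^ 2 + t ^ 2) :=
    Continuous.div continuous_const (by fun_prop) fun t ↦ by positivity
  refine h.mono' hc.aestronglyMeasurable (Eventually.of_forall fun t ↦ ?_)
  rw [Real.norm_eq_abs, abs_of_pos (by positivity), ← mul_inv, one_div]
  refine inv_anti₀ (by positivity) ?_
  rw [mul_add, mul_one]
  exact add_le_add (min_le_left _ _) (le_trans (mul_le_of_le_one_left (sq_nonneg t) (min_le_right _ _)) le_rfl)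

/-- The kernel `t ↦ 1/((σ + it)(σ + 1 + it))` is integrable on `ℝ` for `σ > 0`. [folklore] -/
theorem integrable_kernel {σ : ℝ} (hσ : 0 < σ) :
    Integrable fun t : ℝ ↦ 1 / (((σ : ℂ) + t * I) * ((σ : ℂ) + t * I + 1)) := by
  refine (integrable_inv_sq_add_sq hσ).mono' ?_ (Eventually.of_forall fun t ↦ ?_)
  · refine Continuous.aestronglyMeasurable ?_
    exact Continuous.div continuous_const (by fun_prop) (kernelDen_ne_zero hσ)
  · exact norm_kernel_le hσ t

/-! ## The Mellin pair `(1 − y)⁺ ↔ 1/(s(s+1))` -/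

/-- The Mellin transform of `f(y) = (1 − y)·𝟙_{(0,1]}(y)` is `1/(s(s+1))` for `Re s > 0`
(`hasMellin_one_Ioc` minus `hasMellin_cpow_Ioc 1`). [folklore] -/
theorem hasMellin_oneSub_indicator {s : ℂ} (hs : 0 < s.re) :
    HasMellin ((Ioc 0 1).indicator fun y : ℝ ↦ (1 : ℂ) - y) s (1 / (s * (s + 1))) := by
  have h1 := hasMellin_one_Ioc hs
  have h2 := hasMellin_cpow_Ioc 1 (s := s) (by simp; linarith)
  have h3 := hasMellin_sub h1.1 h2.1
  rw [h1.2, h2.2] at h3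
  have hs0 : s ≠ 0 := by rintro rfl; simp at hs
  have hs1 : s + 1 ≠ 0 := by
    intro h; have := congrArg Complex.re h; simp at this; linarith
  have heq : (fun y : ℝ ↦ (Ioc 0 1).indicator (fun _ : ℝ ↦ (1 : ℂ)) y -
      (Ioc 0 1).indicator (fun t : ℝ ↦ (t : ℂ) ^ (1 : ℂ)) y) =
      (Ioc 0 1).indicator fun y : ℝ ↦ (1 : ℂ) - y := by
    funext y
    by_cases hy : y ∈ Ioc (0 : ℝ) 1
    · simp [Set.indicator_of_mem hy, cpow_one]
    · simp [Set.indicator_of_notMem hy]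
  rw [heq] at h3
  refine ⟨h3.1, ?_⟩
  rw [h3.2]
  field_simp
  ring

/-- **The Perron kernel of order one.** For `σ > 0` and `y > 0`,
`(1/2π) ∫_{−∞}^{∞} y^{−(σ+it)} dt/((σ+it)(σ+1+it)) = (1 − y)⁺`, i.e.
`(1/2πi) ∫_{(σ)} y^{−s} ds/(s(s+1)) = max(1 − y, 0)` (Ingham Ch. II §5 Theorem B with `k = 1`, in
the variable `1/y`; here by Mellin inversion, `mellinInv_mellin_eq`). [folklore] -/
theorem mellinInv_kernel_eq {σ : ℝ} (hσ : 0 < σ) {y : ℝ} (hy : 0 < y) :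
    mellinInv σ (fun s ↦ 1 / (s * (s + 1))) y = ((max (1 - y) 0 : ℝ) : ℂ) := by
  set f : ℝ → ℂ := (Ioc 0 1).indicator fun y : ℝ ↦ (1 : ℂ) - y with hf
  have hmel : ∀ t : ℝ, mellin f (σ + t * I) = 1 / ((σ + t * I) * (σ + t * I + 1)) := fun t ↦
    (hasMellin_oneSub_indicator (s := σ + t * I) (by simpa using hσ)).2
  have hconv : MellinConvergent f σ := (hasMellin_oneSub_indicator (s := σ) (by simpa using hσ)).1
  have hvert : VerticalIntegrable (mellin f) σ := by
    unfold VerticalIntegrable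
    exact (integrable_kernel hσ).congr (Eventually.of_forall fun t ↦ (hmel t).symm)
  -- `f` is continuous on `(0, ∞)`: it agrees there with `y ↦ max (1 - y) 0`
  have hfeq : ∀ u : ℝ, 0 < u → f u = ((max (1 - u) 0 : ℝ) : ℂ) := by
    intro u hu
    by_cases hu1 : u ≤ 1
    · rw [hf, Set.indicator_of_mem (show u ∈ Ioc (0 : ℝ) 1 from ⟨hu, hu1⟩),
        max_eq_left (by linarith)]
      push_cast; ring
    · rw [hf, Set.indicator_of_notMem (show u ∉ Ioc (0 : ℝ) 1 from fun h ↦ hu1 h.2),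
        max_eq_right (by linarith)]
      simp
  have hcont : ContinuousAt f y := by
    have hev : f =ᶠ[𝓝 y] fun u ↦ ((max (1 - u) 0 : ℝ) : ℂ) := by
      filter_upwards [Ioi_mem_nhds hy] with u hu
      exact hfeq u hu
    refine (ContinuousAt.congr ?_ hev.symm)
    exact (Complex.continuous_ofReal.comp ((continuous_const.sub continuous_id).max
      continuous_const)).continuousAt
  have hinv := mellinInv_mellin_eq σ f hy hconv hvert hcont
  rw [hfeq y hy] at hinv
  rw [← hinv]
  unfold mellinInv
  congr 1
  refine integral_congr_ae (Eventually.of_forall fun t ↦ ?_)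
  simp only [hmel t]

/-! ## The Riesz mean `ψ₁` -/

/-- One term: for `x > 0`, `σ > 0`, `n ≥ 1`,
`Λ(n) (x − n)⁺ = (1/2π) ∫ x^{1+σ+it} Λ(n) n^{−(σ+it)} dt/((σ+it)(σ+1+it))`. [folklore] -/
theorem vonMangoldt_mul_posPart_eq_integral {x : ℝ} (hx : 0 < x) {σ : ℝ} (hσ : 0 < σ) {n : ℕ}
    (hn : n ≠ 0) :
    (((Λ n : ℝ) * max (x - n) 0 : ℝ) : ℂ) =
      (1 / (2 * π) : ℂ) * ∫ t : ℝ, (x : ℂ) ^ (1 + (σ + t * I)) *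
        LSeries.term (fun n ↦ (Λ n : ℂ)) (σ + t * I) n *
          (1 / ((σ + t * I) * (σ + t * I + 1))) := by
  have hn0 : (0 : ℝ) < n := Nat.cast_pos.2 (Nat.pos_of_ne_zero hn)
  have hy : 0 < (n : ℝ) / x := div_pos hn0 hx
  have hK := mellinInv_kernel_eq hσ hy
  unfold mellinInv at hK
  -- x · max(1 − n/x, 0) = max(x − n, 0)
  have hmax : (x : ℝ) * max (1 - n / x) 0 = max (x - n) 0 := by
    rw [mul_max_of_nonneg _ _ hx.le, mul_sub, mul_one, mul_div_cancel₀ _ hx.ne', mul_zero]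
  have hlhs : (((Λ n : ℝ) * max (x - n) 0 : ℝ) : ℂ) =
      ((Λ n : ℝ) : ℂ) * (x : ℂ) * ((max (1 - (n : ℝ) / x) 0 : ℝ) : ℂ) := by
    rw [← hmax]; push_cast; ring
  rw [hlhs, ← hK, Complex.real_smul]
  have hx0 : (x : ℂ) ≠ 0 := ofReal_ne_zero.2 hx.ne'
  have hnC : (n : ℂ) ≠ 0 := Nat.cast_ne_zero.2 hn
  -- pointwise identity of the integrands
  have hpt : ∀ t : ℝ, ((Λ n : ℝ) : ℂ) * (x : ℂ) *
      (((n : ℂ) / (x : ℂ)) ^ (-((σ : ℂ) + t * I)) • (1 / (((σ : ℂ) + t * I) * ((σ : ℂ) + t * I + 1)))) =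
      (x : ℂ) ^ (1 + (σ + t * I)) * LSeries.term (fun n ↦ (Λ n : ℂ)) (σ + t * I) n *
        (1 / ((σ + t * I) * (σ + t * I + 1))) := by
    intro t
    set s : ℂ := σ + t * I with hs
    simp only [smul_eq_mul]
    -- (n/x)^{-s} = x^s / n^s
    have hpow : ((n : ℂ) / (x : ℂ)) ^ (-s) = (x : ℂ) ^ s / (n : ℂ) ^ s := by
      rw [show (n : ℂ) / (x : ℂ) = (((n : ℝ) * x⁻¹ : ℝ) : ℂ) by push_cast; ring, cpow_neg,
        ofReal_mul, mul_cpow_ofReal_nonneg hn0.le (inv_nonneg.2 hx.le), ofReal_inv,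
        inv_cpow _ _ ?_, mul_inv, inv_inv]
      · simp only [ofReal_natCast]; ring
      · rw [arg_ofReal_of_nonneg hx.le]; exact Real.pi_pos.ne
    rw [hpow, LSeries.term_of_ne_zero hn]
    conv_rhs => rw [cpow_add _ _ hx0, cpow_one]
    field_simp
  calc ((Λ n : ℝ) : ℂ) * (x : ℂ) * ((((1 / (2 * π) : ℝ)) : ℂ) *
        ∫ t : ℝ, (((n : ℝ) / x : ℝ) : ℂ) ^ (-((σ : ℂ) + t * I)) •
          (fun s : ℂ ↦ 1 / (s * (s + 1))) ((σ : ℂ) + t * I))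
      = (((1 / (2 * π) : ℝ)) : ℂ) * ∫ t : ℝ, ((Λ n : ℝ) : ℂ) * (x : ℂ) *
          ((((n : ℝ) / x : ℝ) : ℂ) ^ (-((σ : ℂ) + t * I)) •
            (fun s : ℂ ↦ 1 / (s * (s + 1))) ((σ : ℂ) + t * I)) := by
        rw [integral_const_mul]; ring
    _ = _ := by
        push_cast
        congr 1
        exact integral_congr_ae (Eventually.of_forall hpt)

/-- **The Riesz mean of `Λ` as a Mellin integral** (Perron's formula of order one; Ingham
Ch. IV §4 (17) with the kernel of Ch. II §5 Theorem B, `k = 1`). For `x > 0` and `σ > 1`,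
`ψ₁(x) := ∑_{n ≤ x} Λ(n)(x − n) = (1/2π) ∫_{−∞}^{∞} x^{1+s} L(Λ, s)/(s(s+1)) dt`, `s = σ + it`,
where `L(Λ, s) = ∑ Λ(n) n^{−s}` (`= −ζ'/ζ(s)`); the integral converges absolutely.
[cite: MontgomeryVaughan2007, §5.1 (5.19)–(5.20)] -/
theorem rieszMean_vonMangoldt_eq_integral_LSeries {x : ℝ} (hx : 0 < x) {σ : ℝ} (hσ : 1 < σ) :
    ((∑ n ∈ Finset.Ioc 0 ⌊x⌋₊, (Λ n : ℝ) * (x - n) : ℝ) : ℂ) =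
      (1 / (2 * π) : ℂ) * ∫ t : ℝ, (x : ℂ) ^ (1 + (σ + t * I)) *
        LSeries (fun n ↦ (Λ n : ℂ)) (σ + t * I) * (1 / ((σ + t * I) * (σ + t * I + 1))) := by
  have hσ0 : 0 < σ := by linarith
  have hx0 : (x : ℂ) ≠ 0 := ofReal_ne_zero.2 hx.ne'
  -- the kernel K, the coefficients G n, the terms F n = G n · K
  set K : ℝ → ℂ := fun t ↦ 1 / (((σ : ℂ) + t * I) * ((σ : ℂ) + t * I + 1)) with hK
  set G : ℕ → ℝ → ℂ := fun n t ↦ (x : ℂ) ^ (1 + (σ + t * I)) *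
    LSeries.term (fun n ↦ (Λ n : ℂ)) (σ + t * I) n with hG
  set F : ℕ → ℝ → ℂ := fun n t ↦ G n t * K t with hF
  have hnormG : ∀ n t, ‖G n t‖ = x ^ (1 + σ) * ‖LSeries.term (fun n ↦ (Λ n : ℂ)) σ n‖ := by
    intro n t
    simp only [hG, norm_mul]
    congr 1
    · rw [norm_cpow_eq_rpow_re_of_pos hx]; simp
    · rcases eq_or_ne n 0 with rfl | hn
      · simp [LSeries.term_zero]
      · rw [LSeries.norm_term_eq, LSeries.norm_term_eq]
        simp [hn]
  have hcontG : ∀ n, Continuous (G n) := by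
    intro n
    simp only [hG]
    refine Continuous.mul ?_ ?_
    · refine continuous_iff_continuousAt.2 fun t ↦ ?_
      exact (continuousAt_const_cpow hx0).comp (f := fun t : ℝ ↦ 1 + ((σ : ℂ) + t * I))
        (by fun_prop)
    · rcases eq_or_ne n 0 with rfl | hn
      · simp only [LSeries.term_zero]; exact continuous_const
      · simp only [LSeries.term_of_ne_zero hn]
        refine continuous_const.div ?_ fun t ↦ ?_
        · refine continuous_iff_continuousAt.2 fun t ↦ ?_
          exact (continuousAt_const_cpow (Nat.cast_ne_zero.2 hn)).comp
            (f := fun t : ℝ ↦ ((σ : ℂ) + t * I)) (by fun_prop)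
        · exact cpow_ne_zero_iff.2 (Or.inl (Nat.cast_ne_zero.2 hn))
  have hintK : Integrable K := integrable_kernel hσ0
  have hintF : ∀ n, Integrable (F n) := fun n ↦
    hintK.bdd_mul (hcontG n).aestronglyMeasurable (Eventually.of_forall fun t ↦ (hnormG n t).le)
  -- summability of the norms
  have hsumF : Summable fun n ↦ ∫ t, ‖F n t‖ := by
    have hS : Summable fun n ↦ ‖LSeries.term (fun n ↦ (Λ n : ℂ)) σ n‖ :=
      (LSeriesSummable_vonMangoldt (s := σ) (by simpa using hσ)).norm
    have := (hS.mul_left (x ^ (1 + σ))).mul_right (∫ t : ℝ, ‖K t‖)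
    refine this.congr fun n ↦ ?_
    rw [← integral_const_mul]
    refine integral_congr_ae (Eventually.of_forall fun t ↦ ?_)
    simp only [hF, norm_mul, hnormG n t]
  -- left side: sum of the terms
  have hterm : ∀ n : ℕ, (((Λ n : ℝ) * max (x - n) 0 : ℝ) : ℂ) =
      (1 / (2 * π) : ℂ) * ∫ t, F n t := by
    intro n
    rcases eq_or_ne n 0 with rfl | hn
    · simp [hF, hG, LSeries.term_zero]
    · exact vonMangoldt_mul_posPart_eq_integral hx hσ0 hn
  have hlhs : ((∑ n ∈ Finset.Ioc 0 ⌊x⌋₊, (Λ n : ℝ) * (x - n) : ℝ) : ℂ) =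
      ∑' n : ℕ, (((Λ n : ℝ) * max (x - n) 0 : ℝ) : ℂ) := by
    have h0 : (0 : ℕ) ∉ Finset.Ioc 0 ⌊x⌋₊ := by simp
    rw [tsum_eq_sum (s := insert 0 (Finset.Ioc 0 ⌊x⌋₊)), Finset.sum_insert h0]
    · simp only [Nat.cast_zero, ArithmeticFunction.map_zero, zero_mul, ofReal_zero, zero_add]
      push_cast
      refine Finset.sum_congr rfl fun n hn ↦ ?_
      rw [Finset.mem_Ioc] at hn
      have hnx : (n : ℝ) ≤ x := (Nat.cast_le.2 hn.2).trans (Nat.floor_le hx.le)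
      rw [max_eq_left (by linarith)]
      push_cast; ring
    · intro n hn
      rw [Finset.mem_insert, not_or, Finset.mem_Ioc, not_and_or, not_lt, not_le] at hn
      obtain ⟨hn0, hn'⟩ := hn
      have hn1 : ⌊x⌋₊ < n := by
        rcases hn' with h | h
        · exact absurd h (not_le.2 (Nat.pos_of_ne_zero hn0))
        · exact h
      have hxn : x < n := by
        have := Nat.lt_of_floor_lt hn1
        exact_mod_cast this
      rw [max_eq_right (by linarith)]
      simp
  rw [hlhs, tsum_congr hterm, tsum_mul_left, integral_tsum_of_summable_integral_norm hintF hsumF]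
  congr 1
  refine integral_congr_ae (Eventually.of_forall fun t ↦ ?_)
  simp only [hF, hG, hK]
  rw [LSeries, ← tsum_mul_left, ← tsum_mul_right]


/-! ## Absolute convergence on the line `Re s = σ > 1` -/

/-- `‖−ζ'/ζ(s)‖ ≤ ∑ Λ(n) n^{−σ}` for `σ = Re s > 1` (the Dirichlet series converges absolutely).
[folklore] -/
theorem norm_logDeriv_zeta_le_tsum {s : ℂ} (hs : 1 < s.re) :
    ‖-deriv riemannZeta s / riemannZeta s‖ ≤
      ∑' n : ℕ, ‖LSeries.term (fun n ↦ (Λ n : ℂ)) (s.re : ℂ) n‖ := by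
  have hS : Summable fun n ↦ ‖LSeries.term (fun n ↦ (Λ n : ℂ)) (s.re : ℂ) n‖ :=
    (LSeriesSummable_vonMangoldt (s := (s.re : ℂ)) (by simpa using hs)).norm
  have h1 : Summable fun n ↦ ‖LSeries.term (fun n ↦ (Λ n : ℂ)) s n‖ :=
    (LSeriesSummable_vonMangoldt hs).norm
  rw [← LSeries_vonMangoldt_eq_deriv_riemannZeta_div hs, LSeries]
  calc ‖∑' n, LSeries.term (fun n ↦ (Λ n : ℂ)) s n‖
      ≤ ∑' n, ‖LSeries.term (fun n ↦ (Λ n : ℂ)) s n‖ := norm_tsum_le_tsum_norm h1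
    _ ≤ ∑' n : ℕ, ‖LSeries.term (fun n ↦ (Λ n : ℂ)) (s.re : ℂ) n‖ :=
        Summable.tsum_le_tsum (fun n ↦ LSeries.norm_term_le_of_re_le_re _ (by simp) n) h1 hS

/-- `t ↦ −ζ'/ζ(σ + it)` is continuous for `σ > 1`. [folklore] -/
theorem continuous_logDeriv_zeta_vertical {σ : ℝ} (hσ : 1 < σ) :
    Continuous fun t : ℝ ↦ -deriv riemannZeta (σ + t * I) / riemannZeta (σ + t * I) := by
  have h1 : ∀ t : ℝ, ((σ : ℂ) + t * I) ≠ 1 := by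
    intro t h
    have := congrArg Complex.re h
    simp at this
    linarith
  have hne : ∀ t : ℝ, riemannZeta ((σ : ℂ) + t * I) ≠ 0 := fun t ↦
    riemannZeta_ne_zero_of_one_lt_re (by simpa using hσ)
  have hpath : Continuous fun t : ℝ ↦ ((σ : ℂ) + t * I) := by fun_prop
  refine Continuous.div (Continuous.neg ?_) ?_ hne
  · refine continuous_iff_continuousAt.2 fun t ↦ ?_
    exact ((analyticOn_riemannZeta _ (h1 t)).deriv.continuousAt).comp
      (f := fun t : ℝ ↦ ((σ : ℂ) + t * I)) hpath.continuousAt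
  · refine continuous_iff_continuousAt.2 fun t ↦ ?_
    exact (differentiableAt_riemannZeta (h1 t)).continuousAt.comp
      (f := fun t : ℝ ↦ ((σ : ℂ) + t * I)) hpath.continuousAt

/-- **Absolute convergence of the Perron integral for `ψ₁`.** For `x > 0`, `σ > 1`, the integrand
`t ↦ x^{1+σ+it} (−ζ'/ζ(σ+it))/((σ+it)(σ+1+it))` is integrable on `ℝ` (it is
`≪ x^{1+σ}/(σ² + t²)`). [folklore] -/
theorem integrable_rieszIntegrand {x : ℝ} (hx : 0 < x) {σ : ℝ} (hσ : 1 < σ) :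
    Integrable fun t : ℝ ↦ (x : ℂ) ^ (1 + (σ + t * I)) *
      (-deriv riemannZeta (σ + t * I) / riemannZeta (σ + t * I)) *
        (1 / ((σ + t * I) * (σ + t * I + 1))) := by
  have hσ0 : 0 < σ := by linarith
  have hx0 : (x : ℂ) ≠ 0 := ofReal_ne_zero.2 hx.ne'
  set A : ℝ := ∑' n : ℕ, ‖LSeries.term (fun n ↦ (Λ n : ℂ)) (σ : ℂ) n‖ with hA
  refine (integrable_kernel hσ0).bdd_mul (c := x ^ (1 + σ) * A) ?_ (Eventually.of_forall fun t ↦ ?_)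
  · refine Continuous.aestronglyMeasurable (Continuous.mul ?_ (continuous_logDeriv_zeta_vertical hσ))
    refine continuous_iff_continuousAt.2 fun t ↦ ?_
    exact (continuousAt_const_cpow hx0).comp (f := fun t : ℝ ↦ 1 + ((σ : ℂ) + t * I))
      (by fun_prop)
  · rw [norm_mul, norm_cpow_eq_rpow_re_of_pos hx]
    have hre : (1 + ((σ : ℂ) + t * I)).re = 1 + σ := by simp
    rw [hre]
    refine mul_le_mul_of_nonneg_left ?_ (by positivity)
    have := norm_logDeriv_zeta_le_tsum (s := (σ : ℂ) + t * I) (by simpa using hσ)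
    simpa using this

/-- **`ψ₁(x) = (1/2πi) ∫_{(σ)} x^{s+1} (−ζ'/ζ(s)) ds/(s(s+1))`** for `x > 0`, `σ > 1` (Ingham
Ch. IV §4 (17)–(18); Montgomery–Vaughan §5.1): with `s = σ + it`,
`∑_{n ≤ x} Λ(n)(x − n) = (1/2π) ∫_{−∞}^{∞} x^{1+s} (−ζ'(s)/ζ(s)) /(s(s+1)) dt`.
[cite: MontgomeryVaughan2007, §5.1 (5.19)–(5.20)] -/
theorem rieszMean_vonMangoldt_eq_integral {x : ℝ} (hx : 0 < x) {σ : ℝ} (hσ : 1 < σ) :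
    ((∑ n ∈ Finset.Ioc 0 ⌊x⌋₊, (Λ n : ℝ) * (x - n) : ℝ) : ℂ) =
      (1 / (2 * π) : ℂ) * ∫ t : ℝ, (x : ℂ) ^ (1 + (σ + t * I)) *
        (-deriv riemannZeta (σ + t * I) / riemannZeta (σ + t * I)) *
          (1 / ((σ + t * I) * (σ + t * I + 1))) := by
  rw [rieszMean_vonMangoldt_eq_integral_LSeries hx hσ]
  congr 1
  refine integral_congr_ae (Eventually.of_forall fun t ↦ ?_)
  simp only
  rw [LSeries_vonMangoldt_eq_deriv_riemannZeta_div (by simpa using hσ), neg_div]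

end Literature.NumberTheory.LFunctions

end
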